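import Mathlib
import HarnessLib
import HarnessLib.Audit
import Summits.HubbardSuperconductivity.Statement

/-!
Route: SpNLargeN

DORMANT since 2026-09-03T13:36:21Z (reconciler: no traction for 5 d (last activity statement-checked at 2026-08-29T12:45:29Z); parked, not closed — `ledger route dormant route-HubbardSuperconductivity-SpNLargeN --off` to reactivate) — unstaffed, not closed; items shared with open routes are served there. `ledger route dormant <id> --off` reactivates.

# Route SpNLargeN — HubbardSuperconductivity (planner plancard, 2026-08-15; realises idea card
`sp2n-flavour-rising-sea`, absorbing the retired sibling `sp2n-rvb-large-n-anchor`)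

## Thesis X (it suffices to show)
RISING SEA IN THE FLAVOUR NUMBER. Embed the summit in the two-parameter family of Sp(2n)-invariant
"pair-Hubbard" torus models
  H_n(U,J) = -Σ_{⟨xy⟩} Σ_{m≤n,σ} c†_{xmσ}c_{ymσ} + (U/n) Σ_x Ps_x† Ps_x - (J/4n) Σ_{x~y (ordered)}
Pb_xy† Pb_xy,
  Ps_x = Σ_m c_{xm↓}c_{xm↑} (on-site Sp(2n)-singlet pair),  Pb_xy = Σ_m (c_{xm↑}c_{ym↓} -
c_{xm↓}c_{ym↑}) (bond singlet pair),
with n·N_L electrons (N_L = 2⌊(1-δ)L²/2⌋) in the S^z_tot = 0 sector of Fock(Orb(FermionTorus 2 L ×ₗ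
Fin n)). At n = 1 this is EXACTLY the t-U-J model
hubbardTorus 2 L 1 U + J Σ_bonds (S_x·S_y - n_x n_y/4) (operator identity J(S·S - nn/4) = -J b†b, b
= Pb/√2, checked on every bond configuration), and at
(n,J) = (1,0) it is the summit's hubbardTorus 2 L 1 U. At n = ∞ mean field is exact and — recorded
TRAP — U is invisible there (the repulsive on-site pair
channel does not condense; (U/n)⟨Ps†Ps⟩ per flavour → U|⟨c↓c↑⟩|² = 0 in a d-wave state), so the n =
∞ theory is plain BCS with the nearest-neighbour
singlet attraction J, whose global minimiser near half filling is the d_{x²-y²} state (g_s ≡ -μ/2 on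
the Fermi curve loses to g_d = cos k₁ - cos k₂);
Mott physics enters at O(1/n). The order parameter is the flavour-singlet B1g bond pair field D_n =
Σ_{x~y} g_d(x,y) Pb_xy (= √2·pairField dWaveFormFactor at n = 1).

X := there are U > 0, δ ∈ (0,1/2) and J₀ > 0 such that for EVERY J in the CLOSED segment [0, J₀],
every normalised (N_L, S^z=0)-sector ground-state
sequence ψ of the t-U-J torus model (even L) has liminf_k (2k)⁻⁴ Re⟨ψ_{2k}, Δ_d†Δ_d ψ_{2k}⟩ > 0
(decl `SpnTarget`; J = 0 is the summit up to the
even-torus bookkeeping `EvenTorusBookkeeping`).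
Lean (elaborates, see SpnTarget): `∃ U δ J₀ : ℝ, 0 < U ∧ δ ∈ Set.Ioo 0 (1/2) ∧ 0 < J₀ ∧ ∀ J ∈
Set.Icc 0 J₀, TUJLRO U J δ` with TUJLRO the every-GS
liminf statement for `hubbardTorus 2 L 1 U - (J/4)•Σ_{x~y} Q_xy†Q_xy`, Q_xy = c_{x↑}c_{y↓} -
c_{x↓}c_{y↑} (written inline over existing decls).

## Two-layer plan (D-0019)
Assembly (pure logic, proved in the planner's Sketch): TUJSmallJ → SuperexchangeDescent →
EvenTorusBookkeeping → HubbardSuperconductivity, i.e. X is reached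
as (0, J₀] (crux TUJSmallJ: the t-U-J model superconducts for every small superexchange attraction
at fixed small U) plus closure of the endpoint J = 0⁺
(crux SuperexchangeDescent). The ENGINE of the route — and its Literature-grade content even if the
descents never close — sits in the two large-n cruxes,
deliberately kept OUTSIDE the assembly as the first layer of a later glued split of TUJSmallJ:
  SpnAnchorLRO (rank 2): ∃ J>0, δ, U₀, a>0, n₀: ∀ n ≥ n₀, ∀ U ∈ [0,U₀], every sector GS of H_n has
B1g pair LRO, liminf_k ⟨D_n†D_n⟩/((2k)⁴n²) ≥ a — a rigorous 1/n expansion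
    (Kopper–Magnen–Rivasseau-type cluster expansion around the U(1)-breaking d-wave saddle; the
phase mode's propagator carries 1/n and is IR-summable in 2+1
    dimensions at T = 0; nodal quasiparticles are 2+1-dimensional Dirac fermions with irrelevant,
1/n-small couplings);
  SpnMeanFieldLimit (rank 3): the n → ∞ limit of the ground-state energy per flavour and site equals
the infimum over ONE-flavour states φ of
    ⟨T-μN⟩_φ - (J/4)Σ_{x~y}|⟨Q_xy⟩_φ|² + U Σ_x |⟨c_{x↓}c_{x↑}⟩_φ|², UNIFORMLY in the side L (flavour
de Finetti / Raggio–Werner made uniform in volume);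
then TUJSmallJ (rank 4) = [anchor at moderate J] + [n₀ = 1: the 1/n series converges down to one
flavour — the first bet] + [weak-J BCS with explicit
attraction], and SuperexchangeDescent (rank 5) = J ↓ 0 at n = 1 — the second bet, where the
Cooper-logarithm barrier returns.
Negative twin (not filed here; belongs to route NoGo): enlarge the spin LENGTH instead — spin-S
t-J/double exchange orders magnetically at large S.

Rationale: WHY THIS LINE (catalogue: rising sea / enrich the symmetry; imports constructive QFT at large N and
quantum mean-field (de Finetti) theory). At
intermediate-to-strong coupling every other route confesses "no small parameter"; the flavour number
n of an Sp(2n) enlargement of spin SU(2) = Sp(2)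
is the one deformation in which the d-wave RVB/BCS saddle of a model with superexchange parentage
becomes EXACT (n = ∞) with corrections organised by
a parameter (1/n) that shrinks no physical scale (order O(t) at n = ∞ for J = O(t), the opposite
corner from WeakCouplingBCS's e^{-1/U²}). Sp(2n), not
SU(n), because Sp singlets are PAIRS (ReadSachdev1991, SachdevRead1991; SU(n) large-n keeps only
particle-hole/flux channels, AffleckMarston1988). The
rigorous large-N fermionic toolbox exists next door: KopperMagnenRivasseau1995 (GN₂, discrete chiral
breaking), DecalanEtAl1991 (GN₃), and — nearest —
MagnenUnterberger2019 (T = 0 2D s-wave BCS for the continuum electron-phonon model: symmetry-broken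
Grassmann measure, gap equation, Goldstone NLσM, with a
sector-1/N à la FeldmanEtAl1993). The flavour family makes N an honest knob of an honest lattice
Hamiltonian whose (n,J) = (1,0) corner is the summit.

RANKED CRUXES
2 SpnAnchorLRO — rigorous 1/n in the broken phase (every-GS B1g LRO ≥ a for n ≥ n₀, uniformly in U ∈
[0,U₀]): the route's new mathematics; would be the
  first short-range 2D lattice fermion Hamiltonian with proved pair LRO in its ground states.
3 SpnMeanFieldLimit — the n = ∞ layer: ground-state energy per flavour → one-flavour BCS-type
variational problem, UNIFORMLY in L (tractable first theorem;
  if it fails the anchor is mis-posed).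
4 TUJSmallJ — n = 1: the t-U-J torus model has every-GS d-wave LRO for all J ∈ (0,J₀] at some fixed
small U > 0, δ (load-bearing; = anchor + "n₀ = 1" bet
  at moderate J, weak-coupling BCS WITH explicit attraction as J → 0; strictly easier than the
summit, still open).
5 SuperexchangeDescent — ∀ U>0, δ: t-U-J LRO for all small J ⇒ pure-Hubbard LRO (closing the segment
at J = 0⁺; the second bet; no mechanism yet — a
  monotone/semicontinuity law in J would settle it, and ∂E/∂J = -Σ⟨b†b⟩ gives only concavity of the
energy).
Support: EvenTorusBookkeeping (provable now: liminf form ⇒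
HasLongRangeOrder∘torusPullback∘pairFieldCorr); target SpnTarget (X); to be filed right
after open: SaddleCertificate (informal; the n = ∞ d-wave window by certified numerics = the fastest
kill) and a definition request naming H_n / D_n
(spnPairHubbardTorus, flavour pair field) so tenure can restate the inline statements over named
decls and state the n = 1 reduction lemma.

KILL CRITERIA. (i) SaddleCertificate empty — at every (J ≤ t, δ ∈ (0,1/2), U ∈ [0,U₀]) the n = ∞
global minimiser is extended-s, dimerised/striped or
normal rather than uniform d_{x²-y²} ⇒ close. (ii) SpnAnchorLRO refuted (e.g. the formal one-loop
1/n correction to the order parameter is infrared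
DIVERGENT at T = 0, or every-GS LRO fails at large n by a flavour-sector degeneracy) ⇒ close. (iii)
SuperexchangeDescent or TUJSmallJ refuted ⇒ the
route closes `refuted`, SpnAnchorLRO/SpnMeanFieldLimit survive as Literature targets (re-home under
a successor route). (iv) Numerics (Sp(4)/Sp(6)
DMRG, never a certificate — SignProblemNPHard) showing a transition in n between ∞ and 1 throughout
the d-wave window ⇒ dormant.

DELIBERATELY NOT DECOMPOSED YET: the cluster expansion itself (small/large-field split for the bond
HS field, the oscillatory on-site channel handled
perturbatively in U/n, Ward identities for the phase mode, the nodal multiscale analysis); the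
canonical-vs-grand-canonical bookkeeping inside the
anchor; the split of TUJSmallJ into [anchor at a point] + [n₀ = 1] + [weak-J BCS] (tenure, after
SpnMeanFieldLimit or SpnAnchorLRO moves); any
quantitative (U₀, J₀, δ) — expected window δ ≈ 0.15–0.3, J ≲ t, small U (PureModelStripeCompetition
keeps us away from (8, 1/8)); the large-S
magnetic twin (NoGo side); the slave-boson/constraint (family B of the retired sibling card,
VojtaSachdev1999 phase diagram, DattaFernandezFrohlich1999
endpoint) — recorded as the alternative should family A's n = ∞ window prove empty.

Novelty: NEAREST PRIOR ART → DELTA. Nearest of all: MagnenUnterberger2019 (arXiv:1902.02337, read pp. 1-2,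
15-18): constructive T = 0 s-wave superconductivity for
the 2D CONTINUUM electron-phonon/BCS model — symmetry-breaking term added and subtracted, multiscale
cluster expansion + Ward identities + sector-1/N
(FeldmanEtAl1993), Thm 1 (symmetry-broken Grassmann measure with cut-offs, RG flow to the gap
scale), Thm 2 (gap equation Γ ≈ ħω_D e^{-π/mλ}, Cooper-pair
correlations ∝ Goldstone propagator); its lattice version (0.40) is printed as an "unproven claim".
Rigorous large N otherwise: KopperMagnenRivasseau1995
(GN₂, DISCRETE chiral breaking), DecalanEtAl1991 (GN₃). Physics, non-rigorous: ReadSachdev1991,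
SachdevRead1991 (Sp(N) large N keeps PAIRING at leading
order), VojtaSachdev1999, VojtaZhangSachdev2000 (Sp(2N) t-J: d-wave vs charge order, formal 1/N),
AffleckMarston1988, KotliarLiu1988. For the mean-field
crux: RaggioWerner1989, KrumnowZimborasEisert2017 (de Finetti-type, NOT uniform in the permuted
subsystem's size). Saddle certificate: DeuchertEtAl2018.
DELTA: (a) the explicit lattice family H_n(U,J) (Sp(2n) pair-Hubbard + bond-singlet attraction)
whose (n,J) = (1,0) corner IS the summit, with the recorded
trap that U is invisible at n = ∞; (b) rigorous 1/n around a U(1)-breaking d-WAVE saddle of a T = 0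
LATTICE Hamiltonian, posed as every-ground-state LRO on
tori (not a cut-off functional measure) with NODAL quasiparticles — absent from KMR (discrete
symmetry) and from Magne  [refs: 10.1007/bf02101599`, 10.21203/rs.3.rs-536320/v1, 10.1103/physrevlett.83.3916, 1902.02337, doi:10.21203/rs.3.rs-536320/v1, MagnenUnterberger2019, FeldmanEtAl1993, KopperMagnenRivasseau1995, DecalanEtAl1991, ReadSachdev1991, SachdevRead1991, VojtaSachdev1999, VojtaZhangSachdev2000, AffleckMarston1988, KotliarLiu1988, RaggioWerner1989, KrumnowZimborasEisert2017, DeuchertEtAl2018]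

Barriers (technique_class: flavour-large-N; saddle-point-expansion; continuation): technique_class: flavour-large-N; saddle-point-expansion; continuation
Literature.Barriers.HubbardSuperconductivity.StrongCouplingCeiling: not in class for the anchor — no
t/U, high-temperature, polymer or Pirogov–Sinai expansion;
the expansion parameter is 1/n at fixed (t,U,J), the fermion determinant is exact, and DFF's
"gapless modes defeat contours" is answered by the explicit
1/n on the Goldstone propagator; the barrier RETURNS in TUJSmallJ (n₀ = 1) and SuperexchangeDescent
(J → 0), declared bets with no small parameter.
Literature.Barriers.HubbardSuperconductivity.GeneralizedHartreeFockNoPairing: the n = ∞ theory IS an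
HFB/BCS self-consistency, but for the ENRICHED model where
it is exact and with pairing driven by the explicit bond-singlet attraction J (B1g-attractive), not
by bare U — consistent with BLS: the bare on-site U stays
A1g-repulsive, does not condense, and is invisible at n = ∞; no quasi-free variational claim is made
about the n = 1, J = 0 model.
Literature.Barriers.HubbardSuperconductivity.WeakCouplingCeiling: not in class for
SpnAnchorLRO/SpnMeanFieldLimit (no expansion in U; gap O(t)e^{-c/J} is a
property of the deformed model at n = ∞); it APPLIES to the J → 0 end of TUJSmallJ (Cooper logarithm
with J in place of U²: a BCS ground state WITH explicit
attraction is still unbuilt for any short-range 2D lattice model — MagnenUnterberger2019 is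
continuum s-wave) and to SuperexchangeDescent; not evaded: bet.
Literature.Barriers.HubbardSuperconductivity.Pertu

History (route lifecycle, newest last):
- 2026-08-16T04:07:15Z · AUTO-CRUX (backfill): SpnTarget — hypotheses of the deciding theorem that nothing in the route derives are cruxes (operator:999:1085951)
- 2026-08-22T19:35:39Z · DORMANT — reconciler: no traction for 5.6 d (last activity statement-grounded at 2026-08-17T04:27:55Z); parked, not closed — `ledger route dormant route-HubbardSupercondu (operator:999:3849674)
- 2026-08-29T10:32:54Z · REACTIVATED — reconciler: reactivated — activity item-proof-filed at 2026-08-29T09:42:31Z after parking at 2026-08-22T19:35:39Z (operator:999:2620480)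
- 2026-09-03T13:36:21Z · DORMANT — reconciler: no traction for 5 d (last activity statement-checked at 2026-08-29T12:45:29Z); parked, not closed — `ledger route dormant route-HubbardSuperconducti (operator:999:3318942)

sub-problem: HubbardSuperconductivity · status: dormant · opened planner-plancard-HubbardSuperconductivity-Hub-caf07d97-0 2026-08-15T10:57:59Z · rev 6 · ledger route-HubbardSuperconductivity-SpNLargeN
GENERATED by the gate from the ledger (D-0016/17). Provers cite these decls: `theorem foo : Summit.HubbardSuperconductivity.HubbardSuperconductivity.Theses.SpNLargeN.<Decl> := …` in Summits/HubbardSuperconductivity/HubbardSuperconductivity/Theorems/<Name>.lean.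
-/

namespace Summit.HubbardSuperconductivity.HubbardSuperconductivity.Theses.SpNLargeN

open scoped BigOperators Topology Manifold Classical MeasureTheory ProbabilityTheory Matrix InnerProductSpace ComplexConjugate ContinuousMap
open Filter Set Function TopologicalSpace MeasureTheory

attribute [summit_statement] _root_.HubbardSuperconductivity

open Literature.Hubbard

/-- item stmt-HubbardSuperconductivity-1663 · crux (kind.auto-crux: conjecture-grade) · rank 0 · open · by planner
why it might fail: Stronger than the summit: every-GS d-wave LRO on a whole CLOSED segment [0,J₀] at one (U,δ); fails if pure Hubbard at the chosen small U, δ is not d_{x²-y²} (KL scale e^{-1/U²} vs d_xy/p channels for δ≳0.4, stripes at larger U) or if J=0⁺ is a first-order endpoint.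
sources: RaghuKivelsonScalapino2010, ArovasBergKivelsonRaghu2022, Scalapino1995, SimkovicEtAl2016
[target] X: for some U > 0, δ ∈ (0,1/2), J₀ > 0 and EVERY J in the closed segment [0, J₀], every
normalised (N_L, S^z=0)-sector ground-state sequence of the n = 1 t-U-J torus model hubbardTorus 2 L
1 U - (J/4)•Σ_{x~y ordered} Q_xy†Q_xy (Q_xy = c_{x↑}c_{y↓} - c_{x↓}c_{y↑}; = Hubbard + J Σ_bonds
(S·S - nn/4)) has liminf_k Re⟨Δ_d†Δ_d⟩_{2(k+1)}/(2(k+1))⁴ > 0. J = 0 is the summit up to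
EvenTorusBookkeeping (tUJ L U 0 = hubbardTorus by simp, checked in the planner's Sketch: TUJSmallJ →
SuperexchangeDescent → SpnTarget). Stronger than the summit (it also asserts small-J t-U-J
superconductivity). || Sources: card sp2n-flavour-rising-sea; Scalapino1995 (order functional). -/
@[route_item "route-HubbardSuperconductivity-SpNLargeN"]
def SpnTarget : Prop :=
  open Literature.MathematicalPhysics.QuantumLattice in ∃ U δ J₀ : ℝ, 0 < U ∧ δ ∈ Set.Ioo (0:ℝ) (1/2) ∧ 0 < J₀ ∧ ∀ J ∈ Set.Icc (0:ℝ) J₀, ∀ (N : ℕ → ℕ) (ψ : ∀ L, Fock (Orb (FermionTorus 2 L))), (∀ L, Even L → N L = 2 * ⌊(1 - δ) * (L : ℝ) ^ 2 / 2⌋₊ ∧ star (ψ L) ⬝ᵥ ψ L = 1 ∧ IsGroundStateInSector (hubbardTorus 2 L 1 U - ((J / 4 : ℝ) : ℂ) • ∑ x : FermionTorus 2 L, ∑ y : FermionTorus 2 L, if (fermionTorusGraph 2 L).Adj x y then (annihilation (orb x 0) * annihilation (orb y 1) - annihilation (orb x 1) * annihilation (orb y 0))ᴴ * (annihilation (orb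 x 0) * annihilation (orb y 1) - annihilation (orb x 1) * annihilation (orb y 0)) else 0) (N L) 0 (ψ L)) → 0 < Filter.liminf (fun k : ℕ => (expect ((pairField dWaveFormFactor (2 * (k + 1)))ᴴ * pairField dWaveFormFactor (2 * (k + 1))) (ψ (2 * (k + 1)))).re / (((2 * (k + 1) : ℕ) : ℝ) ^ 4)) Filter.atTop

/-- item stmt-HubbardSuperconductivity-1664 · crux · rank 2 · open · by planner
why it might fail: No rigorous 1/n exists around a CONTINUOUS-symmetry-breaking saddle (KMR1995: discrete; Kupiainen1980: symmetric phase, asymptotic only); d-wave nodes couple gapless quasiparticles to the T=0 Goldstone mode (non-analytic S_eff); U/n channel oscillatory; every-GS LRO may fail by flavour degeneracy.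
sources: KopperMagnenRivasseau1995, Kupiainen1980, MagnenUnterberger2019, arXiv:1902.02337, FeldmanEtAl1993, SachdevRead1991
[crux, rank 2 — the route's new mathematics] LARGE-n ANCHOR: ∃ J>0, U₀>0, δ∈(0,1/2), a>0, n₀ such
that for all n ≥ n₀ and all U ∈ [0,U₀], every normalised ground state ψ_L of the Sp(2n) pair-Hubbard
torus model H_n(U,J) in the sector (n·N_L electrons, S^z_tot = 0), N_L = 2⌊(1-δ)L²/2⌋, L even, has
flavour-singlet B1g bond-pair LRO: liminf_k Re⟨ψ, D†D ψ⟩_{L=2(k+1)} / (L⁴ n²) ≥ a (a ≈ 16|Δ_bond|²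
at the BCS saddle, n-independent). PLAN: Hubbard–Stratonovich in the attractive bond channel (real
Gaussian weight), fermions integrated exactly ⇒ e^{-n S_eff[Δ]}; the on-site repulsion (U/n)Ps†Ps
treated perturbatively in U/n (it is invisible at n=∞); global minimum of S_eff on the U(1)-orbit of
the uniform d_{x²-y²} configuration (SaddleCertificate); cluster expansion in 1/√n for massive
amplitude/pattern modes à la Kopper–Magnen–Rivasseau, the phase (Goldstone) mode treated by
collective coordinate + Ward identities, its propagator O(1/n) and IR-summable in 2+1 dimensions at
T=0 (∫d²q dω/(ω²+c²q²) < ∞); nodal quasiparticles = 2+1D Dirac fermions with irrelevant gradient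
couplings. Literature-grade even if the descents never close: first short-range 2D lattice fermion
Hamiltonian with prove -/
@[route_item "route-HubbardSuperconductivity-SpNLargeN"]
def SpnAnchorLRO : Prop :=
  open Literature.MathematicalPhysics.QuantumLattice in ∃ J U₀ δ a : ℝ, 0 < J ∧ 0 < U₀ ∧ δ ∈ Set.Ioo (0:ℝ) (1/2) ∧ 0 < a ∧ ∃ n₀ : ℕ, ∀ n ≥ n₀, ∀ U ∈ Set.Icc (0:ℝ) U₀, let c : (L : ℕ) → FermionTorus 2 L → Fin n → Fin 2 → Matrix (Finset (Orb (FermionTorus 2 L ×ₗ Fin n))) (Finset (Orb (FermionTorus 2 L ×ₗ Fin n))) ℂ := fun _ x m σ => annihilation (orb (toLex (x, m)) σ); let H : (L : ℕ) → Matrix (Finset (Orb (FermionTorus 2 L ×ₗ Fin n))) (Finset (Orb (FermionTorus 2 L ×ₗ Fin n))) ℂ := fun L => -(∑ x, ∑ y, ∑ m, ∑ σ, if (fermionTorusGraph 2 L).Adj x y then (c L x m σ)ᴴ * c L y m σ else 0) + ((U / n : ℝ) : ℂ) • (∑ x, (∑ m, c L x m 1 * c L x m 0)ᴴ * (∑ m,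 c L x m 1 * c L x m 0)) - ((J / (4 * n) : ℝ) : ℂ) • (∑ x, ∑ y, if (fermionTorusGraph 2 L).Adj x y then (∑ m, (c L x m 0 * c L y m 1 - c L x m 1 * c L y m 0))ᴴ * (∑ m, (c L x m 0 * c L y m 1 - c L x m 1 * c L y m 0)) else 0); let D : (L : ℕ) → Matrix (Finset (Orb (FermionTorus 2 L ×ₗ Fin n))) (Finset (Orb (FermionTorus 2 L ×ₗ Fin n))) ℂ := fun L => ∑ x, ∑ y, if (fermionTorusGraph 2 L).Adj x y then (if (ofLex x) 0 = (ofLex y) 0 then (-1 : ℂ) else 1) • (∑ m, (c L x m 0 * c L y m 1 - c L x m 1 * c L y m 0)) else 0; ∀ (N : ℕ → ℕ) (ψ : ∀ L, Fock (Orb (FermionTorus 2 L ×ₗ Fin n))), (∀ L, Even L → N L = 2 * ⌊(1 - δ) * (L : ℝ) ^ 2 / 2⌋₊ ∧ star (ψ L) ⬝ᵥ ψ L = 1 ∧ IsGroundStateInSector (H L) (n * N L) 0 (ψ L)) → a ≤ Filter.liminf (fun k : ℕ => (expect ((D (2 * (k + 1)))ᴴ * D (2 * (k + 1))) (ψ (2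 * (k + 1)))).re / ((((2 * (k + 1) : ℕ) : ℝ) ^ 4) * (n : ℝ) ^ 2)) Filter.atTop

/-- item stmt-HubbardSuperconductivity-1665 · crux · rank 3 · open · by planner
why it might fail: n→∞ of a flavour-mean-field model = inf over MIXED one-flavour states (FSV1980, RaggioWerner1989; cf. (1/n)ΣS_i·S_j→0 ≠ pure value 1/4): with the convex +UΣ|⟨c↓c↑⟩|² term the PURE inf used here can be strictly larger, so one (U>0,J,μ,L) kills '∀'; uniformity in L (de Finetti error ∝16^{L²}/n) open.
sources: doi:10.1063/1.524422, RaggioWerner1989, KrumnowZimborasEisert2017, HainzlHamzaSeiringerSolovej2008, BachLiebSolovej1994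
[crux, rank 3 — the n = ∞ layer, tractable first theorem; carry-over L1 of the retired sibling card]
FLAVOUR MEAN-FIELD LIMIT, UNIFORM IN VOLUME (grand-canonical form): for all U ≥ 0, J ≥ 0, μ and ε >
0 there is n₀ such that for all n ≥ n₀ and ALL sides L ≥ 2, | e_n(L,U,J,μ) - mf(L,U,J,μ) | ≤ ε,
where e_n = (inf of Re⟨ψ,(H_n - μN)ψ⟩ over unit ψ ∈ Fock)/(n L²) is the ground-state energy per
flavour and site of the Sp(2n) pair-Hubbard torus model and mf = L⁻² · inf over unit ONE-flavour
states φ ∈ Fock(Orb(FermionTorus 2 L)) (any particle number) of Re⟨φ,(T - μN)φ⟩ - (J/4)Σ_{x~y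
ordered}|⟨φ, Q_xy φ⟩|² + U Σ_x |⟨φ, c_{x↓}c_{x↑} φ⟩|² (T = hubbardTorus 2 L 1 0; each
(1/n)·(flavour-summed singlet bilinear)†(same) term becomes ±|one-flavour expectation|²; by a
Lagrange-multiplier argument the inf is attained on quasi-free (HFB/BCS) states, so mf is the
lattice BCS functional with bond attraction J and on-site repulsion U). Upper bound: flavour
products of the (even) BCS minimiser, error O(1/n) uniformly in L. Lower bound = the content: de
Finetti / Raggio–Werner mean-field theory over the flavour index (even subalgebras of distinct
flavours commute), made UNIFORM in the one-flavour dimens -/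
@[route_item "route-HubbardSuperconductivity-SpNLargeN"]
def SpnMeanFieldLimit : Prop :=
  open Literature.MathematicalPhysics.QuantumLattice in ∀ U J μ ε : ℝ, 0 ≤ U → 0 ≤ J → 0 < ε → ∃ n₀ : ℕ, ∀ n ≥ n₀, ∀ L ≥ 2, let c : FermionTorus 2 L → Fin n → Fin 2 → Matrix (Finset (Orb (FermionTorus 2 L ×ₗ Fin n))) (Finset (Orb (FermionTorus 2 L ×ₗ Fin n))) ℂ := fun x m σ => annihilation (orb (toLex (x, m)) σ); let H : Matrix (Finset (Orb (FermionTorus 2 L ×ₗ Fin n))) (Finset (Orb (FermionTorus 2 L ×ₗ Fin n))) ℂ := -(∑ x, ∑ y, ∑ m, ∑ σ, if (fermionTorusGraph 2 L).Adj x y then (c x m σ)ᴴ * c y m σ else 0) + ((U / n : ℝ) : ℂ) • (∑ x, (∑ m, c x m 1 * c x m 0)ᴴ * (∑ m, c x m 1 * c x m 0)) - ((J / (4 * n) : ℝ) : ℂ) • (∑ x, ∑ y, if (fermionTorusGraph 2 L).Adj x y then (∑ m, (c x m 0 * c y m 1 - c x m 1 * c y m 0))ᴴ * (∑ m, (c x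 m 0 * c y m 1 - c x m 1 * c y m 0)) else 0); let q : FermionTorus 2 L → FermionTorus 2 L → Matrix (Finset (Orb (FermionTorus 2 L))) (Finset (Orb (FermionTorus 2 L))) ℂ := fun x y => annihilation (orb x 0) * annihilation (orb y 1) - annihilation (orb x 1) * annihilation (orb y 0); |sInf {E : ℝ | ∃ ψ : Fock (Orb (FermionTorus 2 L ×ₗ Fin n)), star ψ ⬝ᵥ ψ = 1 ∧ E = (expect (H - (μ : ℂ) • totalNumber) ψ).re} / ((n : ℝ) * (L : ℝ) ^ 2) - sInf {E : ℝ | ∃ φ : Fock (Orb (FermionTorus 2 L)), star φ ⬝ᵥ φ = 1 ∧ E = (expect (hubbardTorus 2 L 1 0 - (μ : ℂ) • totalNumber) φ).re - J / 4 * (∑ x, ∑ y, if (fermionTorusGraph 2 L).Adj x y then ‖expect (q x y) φ‖ ^ 2 else 0) + U * ∑ x, ‖expect (annihilation (orb x 1) * annihilation (orb x 0)) φ‖ ^ 2} / (L : ℝ) ^ 2| ≤ ε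

/-- item stmt-HubbardSuperconductivity-1666 · crux · rank 4 · open · by planner
why it might fail: One (U,δ) for EVERY J∈(0,J₀]: as J→0 the gap is ~e^{-1/(cJ+aU²)} and a BCS ground state WITH explicit attraction is unbuilt for any short-range 2D lattice model (WeakCouplingCeiling, J for U²); every-GS can fail in degenerate sectors; the n₀=1 descent from large n has no small parameter.
sources: MagnenUnterberger2019, RaghuKivelsonScalapino2010, VojtaSachdev1999, BenfattoGiulianiMastropietro2006, Literature.Barriers.HubbardSuperconductivity.WeakCouplingCeiling, KomaTasaki1994
[crux, rank 4 — load-bearing n = 1 statement; to be SPLIT in tenure into (anchor at a point) + (n₀ =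
1 descent) + (weak-J BCS)] SMALL-SUPEREXCHANGE SUPERCONDUCTIVITY OF THE t-U-J MODEL: ∃ U > 0, δ ∈
(0,1/2), J₀ > 0 such that for EVERY J ∈ (0, J₀], every normalised (N_L, S^z=0)-sector ground-state
sequence (even L) of hubbardTorus 2 L 1 U - (J/4)•Σ_{x~y ordered} Q_xy†Q_xy (= Hubbard + J Σ_bonds
(S_x·S_y - n_xn_y/4), antiferromagnetic J = attractive bond-singlet channel) has liminf_k
Re⟨Δ_d†Δ_d⟩_{2(k+1)}/(2(k+1))⁴ > 0 (Δ_d = pairField dWaveFormFactor). Pointwise in J (no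
uniformity): for each fixed J > 0 this is a BCS problem WITH explicit d-wave-attractive coupling ≥
cJ (on-site U is A1g and orthogonal to B1g at leading order, U² helps at second order), strictly
easier than the summit but still unbuilt for any short-range 2D lattice model. Engines: for moderate
J ∈ [J₁, J₀] the large-n anchor SpnAnchorLRO plus the bet n₀ = 1 (explicit one-loop constant
C(U,J,δ) < 1 and a CONVERGENT 1/n); for J → 0 weak-coupling constructive RG with a bare attraction
(Magnen–Unterberger-type, lattice d-wave version). || Sources: MagnenUnterberger2019,
VojtaSachdev1999 (Sp(2N)→N=1 phase diagram, non-r -/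
@[route_item "route-HubbardSuperconductivity-SpNLargeN"]
def TUJSmallJ : Prop :=
  open Literature.MathematicalPhysics.QuantumLattice in ∃ U δ J₀ : ℝ, 0 < U ∧ δ ∈ Set.Ioo (0:ℝ) (1/2) ∧ 0 < J₀ ∧ ∀ J ∈ Set.Ioc (0:ℝ) J₀, ∀ (N : ℕ → ℕ) (ψ : ∀ L, Fock (Orb (FermionTorus 2 L))), (∀ L, Even L → N L = 2 * ⌊(1 - δ) * (L : ℝ) ^ 2 / 2⌋₊ ∧ star (ψ L) ⬝ᵥ ψ L = 1 ∧ IsGroundStateInSector (hubbardTorus 2 L 1 U - ((J / 4 : ℝ) : ℂ) • ∑ x : FermionTorus 2 L, ∑ y : FermionTorus 2 L, if (fermionTorusGraph 2 L).Adj x y then (annihilation (orb x 0) * annihilation (orb y 1) - annihilation (orb x 1) * annihilation (orb y 0))ᴴ * (annihilation (orb x 0) * annihilation (orb y 1) - annihilation (orb x 1) * annihilation (orb y 0)) else 0) (N L) 0 (ψ L)) → 0 < Filter.liminf (fun k : ℕ => (expect ((pairField dWaveFormFactor (2 * (k + 1)))ᴴ * pairField dWaveFormFactor (2 * (k + 1)))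 (ψ (2 * (k + 1)))).re / (((2 * (k + 1) : ℕ) : ℝ) ^ 4)) Filter.atTop

/-- item stmt-HubbardSuperconductivity-1667 · crux · rank 5 · open · by planner
why it might fail: ∀(U,δ) includes Kohn–Luttinger channel-degeneracy points (d_{x²-y²}/d_xy at n≈0.6 ⇒ δ≈0.4, RKS2010 p.7): there every J>0 selects d_{x²-y²}, so the hypothesis can hold while J=0 ground states are d_xy-like on subsequences; no semicontinuity of every-GS LRO at J=0⁺; elsewhere vacuous or summit-hard.
sources: RaghuKivelsonScalapino2010, arXiv:1002.0591, Hlubina1999, ArovasBergKivelsonRaghu2022, KomaTasaki1994, Literature.Barriers.HubbardSuperconductivity.PerturbativeInvisibilityOfPairing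
[crux, rank 5 — the second bet: closing the segment at J = 0⁺] SUPEREXCHANGE DESCENT: for ALL U > 0
and δ ∈ (0,1/2): IF there is J₀ > 0 such that for every J ∈ (0, J₀] every normalised
(N_L,S^z=0)-sector GS sequence of the t-U-J torus model (as in TUJSmallJ) has liminf_k
Re⟨Δ_d†Δ_d⟩_{2(k+1)}/(2(k+1))⁴ > 0, THEN the same holds for the pure Hubbard model hubbardTorus 2 L
1 U at (U, δ). A transfer LAW (universally quantified so that it composes with TUJSmallJ's
existential witness; vacuous wherever the hypothesis fails, e.g. Nagaoka/stripe regions).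
Physically: superexchange only ENHANCES the d-wave pairing that U already produces at second order
(Kohn–Luttinger), so every-GS LRO should not switch off exactly at J = 0⁺ (a first-order endpoint at
J = 0 is non-generic). Mathematically no mechanism is known: ∂E/∂J = -Σ⟨b†b⟩ gives concavity of the
energy in J, not monotonicity/semicontinuity of LRO; at finite L the set of J=0 ground states can be
LARGER (upper semicontinuity goes the wrong way). A proof would be a structural statement (e.g.
lower semicontinuity of every-GS LRO under vanishing bond-singlet attraction) — this is where the
Cooper-logarithm barrier returns (at J = 0 the scale -/
@[route_item "route-HubbardSuperconductivity-SpNLargeN"]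
def SuperexchangeDescent : Prop :=
  open Literature.MathematicalPhysics.QuantumLattice in ∀ U δ : ℝ, 0 < U → δ ∈ Set.Ioo (0:ℝ) (1/2) → (∃ J₀ : ℝ, 0 < J₀ ∧ ∀ J ∈ Set.Ioc (0:ℝ) J₀, ∀ (N : ℕ → ℕ) (ψ : ∀ L, Fock (Orb (FermionTorus 2 L))), (∀ L, Even L → N L = 2 * ⌊(1 - δ) * (L : ℝ) ^ 2 / 2⌋₊ ∧ star (ψ L) ⬝ᵥ ψ L = 1 ∧ IsGroundStateInSector (hubbardTorus 2 L 1 U - ((J / 4 : ℝ) : ℂ) • ∑ x : FermionTorus 2 L, ∑ y : FermionTorus 2 L, if (fermionTorusGraph 2 L).Adj x y then (annihilation (orb x 0) * annihilation (orb y 1) - annihilation (orb x 1) * annihilation (orb y 0))ᴴ * (annihilation (orb x 0) * annihilation (orb y 1) - annihilation (orb x 1) * annihilation (orb y 0)) else 0) (N L) 0 (ψ L)) → 0 < Filter.liminf (fun k : ℕ => (expect ((pairField dWaveFormFactor (2 * (k + 1)))ᴴ * pairField dWaveFormFactor (2 * (k + 1))) (ψ (2 * (k + 1)))).re / (((2 *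 (k + 1) : ℕ) : ℝ) ^ 4)) Filter.atTop) → ∀ (N : ℕ → ℕ) (ψ : ∀ L, Fock (Orb (FermionTorus 2 L))), (∀ L, Even L → N L = 2 * ⌊(1 - δ) * (L : ℝ) ^ 2 / 2⌋₊ ∧ star (ψ L) ⬝ᵥ ψ L = 1 ∧ IsGroundStateInSector (hubbardTorus 2 L 1 U) (N L) 0 (ψ L)) → 0 < Filter.liminf (fun k : ℕ => (expect ((pairField dWaveFormFactor (2 * (k + 1)))ᴴ * pairField dWaveFormFactor (2 * (k + 1))) (ψ (2 * (k + 1)))).re / (((2 * (k + 1) : ℕ) : ℝ) ^ 4)) Filter.atTop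

/-- item stmt-HubbardSuperconductivity-19075 · crux · rank 6 · open · by planner
why it might fail: J-uniformity down to J→0⁺ is the Cooper-log barrier in disguise: for J ≪ U² the gap ~e^{-1/(αJ+βU²)} and k₀ ~ ξ must stay bounded (WeakCouplingCeiling; BCS with bare attraction unbuilt on 2D lattices); every-GS floors can fail in degenerate sectors; t-U-J numerics see d-wave only at J ≳ 0.3t.
sources: MagnenUnterberger2019, RaghuKivelsonScalapino2010, ArovasBergKivelsonRaghu2022, Scalapino1995, KomaTasaki1994, Literature.Barriers.HubbardSuperconductivity.WeakCouplingCeiling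
[crux] UNIFORM t-U-J WINDOW FLOOR (piece 1 of the strategist's typed decomposition of SpnTarget,
2026-08-17; the REGULARISED side of the vanishing-regularisation seam — it speaks ONLY about J > 0):
there are 0 ≤ U₁ < U₂ and δ ∈ (0,1/2) such that for every repulsion U in the open window (U₁,U₂)
there are J₀ > 0, a > 0 and k₀ with: for every exchange J ∈ (0, J₀], every even side L = 2(k+1) ≥
2(k₀+1) and every unit ground state ψ of the t-U-J torus model hubbardTorus 2 L 1 U − (J/4)Σ_{x∼y}
b†_{xy}b_{xy} (b_{xy} = c_{x↑}c_{y↓} − c_{x↓}c_{y↑}; = Hubbard + JΣ_bonds(S_x·S_y − n_xn_y/4)) in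
the sector (N_L = 2⌊(1−δ)L²/2⌋, S^z = 0), the d_{x²−y²} pair-field density obeys L⁻⁴ Re⟨ψ, Δ_d†Δ_d
ψ⟩ ≥ a. The constants a, k₀ are UNIFORM in J ∈ (0,J₀] (they may depend on U): every model in the
family has an EXPLICIT bond-singlet (B1g-attractive) coupling J > 0, and the content beyond
TUJSmallJ (which it implies: liminf ≥ a) is that the floor does not degrade as J → 0⁺ — the honest
form of 'no first-order endpoint at J = 0⁺', stated without the pure model. Open U-window (not one
U) so that the assembly can dodge the measure-zero set of repulsions excluded by EndpointStability.
Engines: large-n Sp(2n) -/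
@[route_item "route-HubbardSuperconductivity-SpNLargeN"]
def TUJWindowFloor : Prop :=
  open Literature.MathematicalPhysics.QuantumLattice in ∃ U₁ U₂ δ : ℝ, 0 ≤ U₁ ∧ U₁ < U₂ ∧ δ ∈ Set.Ioo (0:ℝ) (1/2) ∧ ∀ U ∈ Set.Ioo U₁ U₂, ∃ J₀ a : ℝ, 0 < J₀ ∧ 0 < a ∧ ∃ k₀ : ℕ, ∀ J ∈ Set.Ioc (0:ℝ) J₀, ∀ k : ℕ, k₀ ≤ k → ∀ ψ : Fock (Orb (FermionTorus 2 (2 * (k + 1)))), star ψ ⬝ᵥ ψ = 1 → IsGroundStateInSector (hubbardTorus 2 (2 * (k + 1)) 1 U - ((J / 4 : ℝ) : ℂ) • ∑ x : FermionTorus 2 (2 * (k + 1)), ∑ y : FermionTorus 2 (2 * (k + 1)), if (fermionTorusGraph 2 (2 * (k + 1))).Adj x y then (annihilation (orb x 0) * annihilation (orb y 1) - annihilation (orb x 1) * annihilation (orb y 0))ᴴ * (annihilation (orb x 0) * annihilation (orb y 1) - annihilation (orb x 1) * annihilation (orb y 0)) else 0) (2 * ⌊(1 - δ) * ((2 * (k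 + 1) : ℕ) : ℝ) ^ 2 / 2⌋₊) 0 ψ → a ≤ (expect ((pairField dWaveFormFactor (2 * (k + 1)))ᴴ * pairField dWaveFormFactor (2 * (k + 1))) ψ).re / (((2 * (k + 1) : ℕ) : ℝ) ^ 4)

/-- item stmt-HubbardSuperconductivity-19076 · crux · rank 7 · open · by planner
why it might fail: A systematic accidental GS degeneracy of the doped Hubbard torus (open-shell S / momentum multiplets tying identically in U, or an η-pairing remnant) split at first order by the SU(2)×space-group-symmetric, η-breaking −(J/4)Σb†b, at infinitely many even L (4×4 ED: crossings, S=1/K≠0 GS).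
sources: Kato1966, Tasaki2020, Lieb1989, doi:10.1103/RevModPhys.66.763, doi:10.1103/PhysRevB.42.6877
[crux] ENDPOINT SPECTRAL STABILITY AT J = 0 (piece 2 of the strategist's typed decomposition of
SpnTarget, 2026-08-17; the LIMIT side of the vanishing-regularisation seam — it carries NO order
content): for every doping δ ∈ (0,1/2) and every open window of repulsions 0 ≤ U₁ < U₂ there is U ∈
(U₁,U₂) and k₀ such that for every even side L = 2(k+1) ≥ 2(k₀+1), every unit ground state φ of the
PURE Hubbard torus hubbardTorus 2 L 1 U in the sector (N_L = 2⌊(1−δ)L²/2⌋, S^z = 0) is the limit φ =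
lim_n ψ_n of unit sector ground states ψ_n of the t-U-J model hubbardTorus 2 L 1 U − (J_n/4)Σ_{x∼y}
b†_{xy}b_{xy} along some sequence J_n > 0, J_n → 0. Finite-dimensional analytic perturbation theory
(Kato II §1, §6; Rellich) gives for free that limits of J→0⁺ ground states are J = 0 ground states
and that the limiting ground space W ⊆ V₀ := GS space at J = 0; the statement is W = V₀, i.e. the
exchange perturbation −(1/4)Σ b†b does NOT split the J = 0 ground multiplet (to all orders). This
holds automatically when V₀ is an irreducible multiplet of the symmetries shared by both models
(lattice translations and point group, spin rotations, time reversal — the exchange term has them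
all; it breaks on -/
@[route_item "route-HubbardSuperconductivity-SpNLargeN"]
def EndpointStability : Prop :=
  open Literature.MathematicalPhysics.QuantumLattice in ∀ δ ∈ Set.Ioo (0:ℝ) (1/2), ∀ U₁ U₂ : ℝ, 0 ≤ U₁ → U₁ < U₂ → ∃ U ∈ Set.Ioo U₁ U₂, ∃ k₀ : ℕ, ∀ k : ℕ, k₀ ≤ k → ∀ φ : Fock (Orb (FermionTorus 2 (2 * (k + 1)))), star φ ⬝ᵥ φ = 1 → IsGroundStateInSector (hubbardTorus 2 (2 * (k + 1)) 1 U) (2 * ⌊(1 - δ) * ((2 * (k + 1) : ℕ) : ℝ) ^ 2 / 2⌋₊) 0 φ → ∃ (Js : ℕ → ℝ) (ψs : ℕ → Fock (Orb (FermionTorus 2 (2 * (k + 1))))), (∀ n, 0 < Js n) ∧ Filter.Tendsto Js Filter.atTop (nhds 0) ∧ (∀ n, star (ψs n) ⬝ᵥ ψs n = 1 ∧ IsGroundStateInSector (hubbardTorus 2 (2 * (k + 1)) 1 U - ((Js n / 4 : ℝ) : ℂ) • ∑ x : FermionTorus 2 (2 * (k + 1)), ∑ y : FermionTorus 2 (2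 * (k + 1)), if (fermionTorusGraph 2 (2 * (k + 1))).Adj x y then (annihilation (orb x 0) * annihilation (orb y 1) - annihilation (orb x 1) * annihilation (orb y 0))ᴴ * (annihilation (orb x 0) * annihilation (orb y 1) - annihilation (orb x 1) * annihilation (orb y 0)) else 0) (2 * ⌊(1 - δ) * ((2 * (k + 1) : ℕ) : ℝ) ^ 2 / 2⌋₊) 0 (ψs n)) ∧ Filter.Tendsto ψs Filter.atTop (nhds φ)

/-- item stmt-HubbardSuperconductivity-14259 · support · rank 9 · closed · proved by Summit.HubbardSuperconductivity.HubbardSuperconductivity.Theorems.SpNLargeN.spnTargetOfCruxes_proof @ 0685434b1c04 (prover) · by planner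
[support] GLUE REACHING THE TARGET X (route-choice repair 2026-08-16, option (a)): the two n = 1
cruxes give SpnTarget on the CLOSED segment [0, J₀] — for J ∈ (0, J₀] it is TUJSmallJ verbatim at
TUJSmallJ's own witness (U, δ, J₀); the endpoint J = 0 is SuperexchangeDescent applied at that (U,
δ) (its hypothesis is literally TUJSmallJ's conclusion there), followed by the bookkeeping identity
hubbardTorus 2 L 1 U - ((0/4:ℝ):ℂ) • Σ_{x~y} Q_xy†Q_xy = hubbardTorus 2 L 1 U (simp only [zero_div,
Complex.ofReal_zero, zero_smul, sub_zero]). Pure logic; proved as an `example` in the planner's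
Sketch.lean (lean rc 0, 10 lines): obtain ⟨U,δ,J₀,…⟩ from TUJSmallJ, case J = 0 ∨ 0 < J via
hJ.1.eq_or_lt. With this item the deciding theorem runs through the target: closes : SpnTarget →
EvenTorusBookkeeping → HubbardSuperconductivity. [deps: TUJSmallJ, SuperexchangeDescent, SpnTarget]
[difficulty: provable-now] -/
@[route_item "route-HubbardSuperconductivity-SpNLargeN"]
def SpnTargetOfCruxes : Prop :=
  TUJSmallJ → SuperexchangeDescent → SpnTarget

-- `SpnTargetOfCruxes` holds: proved by `Summit.HubbardSuperconductivity.HubbardSuperconductivity.Theorems.SpNLargeN.spnTargetOfCruxes_proof` @ 0685434b1c04 (its module imports this route file, so no `_holds` link can be stated here).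

/-- item stmt-HubbardSuperconductivity-1668 · support · rank 9 · closed · proved by Summit.HubbardSuperconductivity.HubbardSuperconductivity.Theorems.SpNLargeN.evenTorusBookkeeping_proof @ 0685434b1c04 (prover) · by planner
sources: Scalapino1995, FriedliVelenik2017
[support, provable now] EVEN-TORUS BOOKKEEPING: for any family ψ of torus states, 0 < liminf_k
Re⟨ψ_{L}, (pairField d L)ᴴ pairField d L ψ_L⟩ / L⁴ along L = 2(k+1) implies the summit's literal
conclusion HasLongRangeOrder (fun k => halfOpenBox 2 (2k)) (fun k => torusPullback (pairFieldCorr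
dWaveFormFactor ψ) (2k)). Proof: expect_pairField_conjTranspose_mul (⟨Δ†Δ⟩ = Σ_{x,y}⟨P_x†P_y⟩),
torusProj_bijOn_halfOpenBox (the box {0..2k-1}² is a faithful copy of the torus), card_halfOpenBox
((2k)² sites ⇒ normalisation (2k)⁻⁴), and invariance of liminf under the index shift k ↦ k+1 (the k
= 0 term is 0). Shared glue for every S-side route stated in liminf form. || Sources: Scalapino1995
§2 eq. (2.4), FriedliVelenik2017 §3.7.2. -/
@[route_item "route-HubbardSuperconductivity-SpNLargeN"]
def EvenTorusBookkeeping : Prop :=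
  open Literature.MathematicalPhysics.QuantumLattice Literature.Probability.LatticeModels in ∀ (ψ : ∀ L, Fock (Orb (FermionTorus 2 L))), 0 < Filter.liminf (fun k : ℕ => (expect ((pairField dWaveFormFactor (2 * (k + 1)))ᴴ * pairField dWaveFormFactor (2 * (k + 1))) (ψ (2 * (k + 1)))).re / (((2 * (k + 1) : ℕ) : ℝ) ^ 4)) Filter.atTop → HasLongRangeOrder (fun k => halfOpenBox 2 (2 * k)) (fun k => torusPullback (pairFieldCorr dWaveFormFactor ψ) (2 * k))

-- `EvenTorusBookkeeping` holds: proved by `Summit.HubbardSuperconductivity.HubbardSuperconductivity.Theorems.SpNLargeN.evenTorusBookkeeping_proof` @ 0685434b1c04 (its module imports this route file, so no `_holds` link can be stated here).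

-- item stmt-HubbardSuperconductivity-1785 · support · rank 9 · open · by planner — informal only, no Lean statement yet:
--   [support] SADDLE CERTIFICATE (the n = ∞ d-wave window; certified numerics; the route's FASTEST KILL
--   — run it first). For the one-flavour functional of SpnMeanFieldLimit, mf_{U,J,μ}(φ) = Re⟨φ,(T -
--   μN)φ⟩ - (J/4)Σ_{x~y ordered}|⟨φ,Q_xy φ⟩|² + U Σ_x|⟨φ,c_{x↓}c_{x↑}φ⟩|² on Fock(Orb(FermionTorus 2 L))
--   (T = hubbardTorus 2 L 1 0; equivalently the lattice HFB/BCS functional with bond-singlet attraction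
--   J and on-site repulsion U), CLAIM: there are J₀ > 0, 0 < δ₁ < δ₂ < 1/2, U₀ > 0 and, for each J ∈
--   (0,J₀], constants Δ(J) ≥ c e^{-C/J} > 0, κ(J) > 0, L₀(J) such that for all U ∈ [0,U₀], all μ with
--   density

/-- item stmt-HubbardSuperconductivity-19084 · support · rank 9 · closed · proved by Summit.HubbardSuperconductivity.HubbardSuperconductivity.Theorems.SpNLargeN.spnTargetOfPieces_proof (prover) · by planner
[support] GLUE OF THE STRATEGIST'S TYPED DECOMPOSITION OF THE DECIDING CRUX (BC2 redirect of
SpnTarget, 2026-08-17): TUJWindowFloor → EndpointStability → SpnTarget. With this item SpnTarget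
(stmt-HubbardSuperconductivity-1663) is DERIVED from the two pieces TUJWindowFloor
(stmt-HubbardSuperconductivity-19075; J > 0 only, J-uniform every-GS floor on an open U-window) and
EndpointStability (stmt-HubbardSuperconductivity-19076; order-free spectral faithfulness of the
limit J → 0⁺ at a dense set of U), neither of which mentions the pure Hubbard model's order. ALREADY
PROVED, sorry-free, by the strategist: theorem `spnTarget_of_windowFloor_of_endpointStability` in
Cruxes/SpnTarget/Split.lean (= evidence Split.lean on stmt-HubbardSuperconductivity-1663; lean rc 0,
0 sorry, axioms propext / Classical.choice / Quot.sound; hypotheses are the two piece statements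
VERBATIM, so `fun h₁ h₂ => spnTarget_of_windowFloor_of_endpointStability h₁ h₂` closes this item
once a prover lands that file as
Summits/HubbardSuperconductivity/HubbardSuperconductivity/Theorems/SpNLargeNSpnTargetSplit.lean —
planners cannot write Theorems/). The proof is NOT a one-line seam (~45 tactic lines): pick U in the
floor -/
@[route_item "route-HubbardSuperconductivity-SpNLargeN"]
def SpnTargetOfPieces : Prop :=
  TUJWindowFloor → EndpointStability → SpnTarget

-- `SpnTargetOfPieces` holds: proved by `Summit.HubbardSuperconductivity.HubbardSuperconductivity.Theorems.SpNLargeN.spnTargetOfPieces_proof` (its module imports this route file, so no `_holds` link can be stated here).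

/-- item stmt-HubbardSuperconductivity-1669 · assembly · rank 1 · closed · proved by Summit.HubbardSuperconductivity.HubbardSuperconductivity.Theorems.SpNLargeN.spNLargeN_assembly_proof @ 0685434b1c04 (prover) · by planner
[assembly] TUJSmallJ → SuperexchangeDescent → EvenTorusBookkeeping → HubbardSuperconductivity: take
(U, δ, J₀) from TUJSmallJ (U > 0, δ ∈ (0,1/2)); SuperexchangeDescent U δ turns t-U-J LRO on (0,J₀]
into the liminf form of d-wave LRO for every HYP-sequence of hubbardTorus 2 L 1 U;
EvenTorusBookkeeping converts to HasLongRangeOrder∘torusPullback∘pairFieldCorr. Pure logic (proved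
by `example` in the planner's Sketch.lean, 6 lines). The large-n cruxes SpnAnchorLRO /
SpnMeanFieldLimit are the ENGINE for TUJSmallJ and enter formally when TUJSmallJ is split (tenure).
|| Sources: Scalapino1995. -/
@[route_item "route-HubbardSuperconductivity-SpNLargeN"]
def Assembly : Prop :=
  TUJSmallJ → SuperexchangeDescent → EvenTorusBookkeeping → HubbardSuperconductivity

-- `Assembly` holds: proved by `Summit.HubbardSuperconductivity.HubbardSuperconductivity.Theorems.SpNLargeN.spNLargeN_assembly_proof` @ 0685434b1c04 (its module imports this route file, so no `_holds` link can be stated here).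

/-! D-0027 §2.1 — DECIDING THEOREM (planner-authored via `route open/edit --closes-file`; by planner-rchoice-HubbardSuperconductivity-SpNLa-fdb1c0c0-0 2026-08-16T03:12:42Z):
its hypotheses are this route's items and its conclusion the sub-problem Statement (glue_lint), and it elaborates with this file. -/

@[closes "route-HubbardSuperconductivity-SpNLargeN"] theorem closes (hX : SpnTarget) (hB : EvenTorusBookkeeping) :
    _root_.HubbardSuperconductivity := by
  obtain ⟨U, δ, J₀, hU, hδ, hJ₀, hJ⟩ := hX
  have h0 := hJ 0 ⟨le_rfl, hJ₀.le⟩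
  simp only [zero_div, Complex.ofReal_zero, zero_smul, sub_zero] at h0
  unfold _root_.HubbardSuperconductivity Literature.Hubbard.DWaveSuperconductivityHubbard
  exact ⟨U, hU, δ, hδ, fun N ψ hadm => hB ψ (h0 N ψ hadm)⟩

end Summit.HubbardSuperconductivity.HubbardSuperconductivity.Theses.SpNLargeN
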